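import Mathlib
import Summits.Ventures.FusionMHD.Models.RwmFRS1EqSolution
import Summits.Ventures.FusionMHD.Models.RwmFRS1CriticalWall
import HarnessLib

/-!
# F3.r4 instance «RwmFRS1Eq» (force-balanced twin of row «F3.r4-FRS1-RWM31»): THE SENTENCES for the EXACT ideal-MHD
# equilibrium — no-wall instability of the external `(3,1)` mode, the ideal-wall window, the critical wall radius, the RWM rate

Port of `RwmFRS1Energy.lean` + `RwmFRS1CriticalWall.lean` (model-6 g6) to MODEL M_RWM,eq = lit-4's exact force-balanced FRS1
screw pinch `TearingFRS1.EqSigmaR5.hl5` (`isRadialPressureBalance5`: caveat W6 of the zero-β row does NOT arise) + vacuum +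
thin resistive wall, `R₀ = 5a` DECLARED, wall radii `21/20·a`, `11/10·a` DECLARED SYNTHETIC; CLASS C = external `(3,1)`.
Kernel marginal solution `Eq.xi` with `14.2000991 < L_eq < 14.2000992` (`RwmFRS1EqSolution.lean`); boundary form, wall
factors and Bessel brackets are those of the zero-β row BY NAME (`RwmFRS1.boundaryForm_eq`, `lambdaWall_21_bounds`,
`lambdaWall_22_le`, `lambdaInf_bounds`). CERTIFIED: `externalEnergy_xi`; `lambdaCrit_bounds` `Λ_crit ∈ (4.91147, 4.91148)`;
**`dWinf_neg`** + `noWall_not_stable` (`δW_∞ < 0`); **`dWb_pos`** + `idealWall_stable` + `idealWall_window` (`δW_b > 0`,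
every admissible displacement positive, for every wall `1 < b/a ≤ 21/20`); `dWb_neg` + `dWb_neg_far` (`δW_b < 0` for
`b/a ≥ 11/10`); `externalModes_iff` (lit-4's test with the kernel `ξ₁`); critical wall radius `b*` with `dWb_pos_iff`,
`criticalWallRadius_bounds` `21/20 < b* < 11/10`, `idealWall_stable_iff`; **`rwm_rate` `201/100 < γτ_w < 203/100`** at
`b = 21/20·a`, `rwm_grows`. VALIDATED (not load-bearing): float `L = 14.2000991`, `Λ_crit = 4.91147`, `γτ_w = 2.0205`,
`b_crit = 1.0709a`. Never «stable/unstable» without «MODEL M_RWM,eq, mode (3,1)»; nothing about a device. [instance data]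
-/

noncomputable section

open Set Filter Polynomial Literature.Analysis.ODE Literature.Analysis.FunctionSpaces
  Literature.MathematicalPhysics.MHD Literature.MathematicalPhysics.MHD.ScrewPinch
open scoped Topology

namespace Summit.Ventures.FusionMHD.Models

namespace RwmFRS1

namespace Eq

/-! ### The reference energies of the marginal solution are the boundary form (Freidberg (11.148)) -/

/-- **(11.148) FOR `ξ₁`**: for every wall factor `Λ`, the external energy of the axis-regular marginal solution is the
boundary form: `externalEnergy 3 k 1 Λ ξ₁ = δŴ(L, Λ)·ξ₁(1)²`, `L = ξ₁′(1)/ξ₁(1)` (lit-4's (11.117)).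
[cite: Freidberg2014, §11.5.6 eq. (11.148)] -/
theorem externalEnergy_xi (Λ : ℝ) :
    Peq.externalEnergy 3 kk 1 Λ Eq.xi = RwmFRS1.boundaryForm (1 * deriv Eq.xi 1 / Eq.xi 1) Λ * Eq.xi 1 ^ 2 := by
  obtain ⟨hBθ, hBz, hp, hBθ0⟩ := Eq.profile_regular (51 / 50)
  have hF : ∀ r ∈ Ioc (0 : ℝ) 1, Peq.kDotB 3 kk r ≠ 0 := fun r hr => Eq.kDotB_ne_zero hr.1 (by nlinarith [hr.1, hr.2])
  have hODE : ∀ r ∈ Ioo (0 : ℝ) 1,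
      HasDerivAt (fun s => Peq.newcombF 3 kk s * deriv Eq.xi s) (Peq.newcombG 3 kk r * Eq.xi r) r :=
    fun r hr => Eq.xi_newcomb ⟨hr.1, by linarith [hr.2]⟩
  have hE := Profile.fluidEnergy_eq_boundary_of_solution (P := Peq) (m := 3) (k := kk) one_pos
    (by norm_num : (1 : ℝ) < 51 / 50) (by norm_num) hBθ hBz hp hBθ0 hF Eq.xi_contDiffOn hODE
  have hx : Eq.xi 1 ≠ 0 := Eq.xi_ne_zero 1 ⟨one_pos, le_rfl⟩
  unfold Profile.externalEnergy
  rw [hE, RwmFRS1.boundaryForm_eq]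
  unfold Profile.newcombF
  obtain ⟨e1, e2, e3, -⟩ := Eq.edge_values
  rw [e1, e2, e3]
  field_simp
  ring

/-- The NO-WALL reference energy `δW_∞` of the marginal solution (per `2π²R₀/μ₀`). [cite: Freidberg2014, §11.5.6 eq. (11.149)] -/
def dWinf : ℝ := Peq.externalEnergy 3 kk 1 (Vacuum.wallFactorInf 3 kk 1) Eq.xi

/-- The IDEAL-WALL reference energy `δW_b` of the marginal solution, wall at `r = b`. [cite: Freidberg2014, §11.5.6 eq. (11.149)] -/
def dWb (b : ℝ) : ℝ := Peq.externalEnergy 3 kk 1 (Vacuum.wallFactor 3 kk 1 b) Eq.xi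

/-- `ξ₁(1)² > 0`. [instance data] -/
theorem xi_one_sq_pos : 0 < Eq.xi 1 ^ 2 := by
  have := Eq.xi_pos one_pos le_rfl
  positivity

/-! ### Sentence 1: the critical wall factor -/

/-- **`Λ_crit,eq ∈ (4.91147, 4.91148)`** (from `14.2000991 < L_eq < 14.2000992`). [instance data] -/
theorem lambdaCrit_bounds : (491147 / 100000 : ℝ) < RwmFRS1.lambdaCrit (1 * deriv Eq.xi 1 / Eq.xi 1) ∧
    RwmFRS1.lambdaCrit (1 * deriv Eq.xi 1 / Eq.xi 1) < (491148 / 100000 : ℝ) := by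
  obtain ⟨h1, h2⟩ := Eq.L_bounds
  unfold RwmFRS1.lambdaCrit
  constructor <;> linarith

/-! ### Sentences 2–3: energies of the marginal solution and the external-mode test -/

/-- **SENTENCE 2 (no wall): `δW_∞ < 0`** — `Λ_∞ < 1 < Λ_crit`. [cite: Freidberg2014, §11.5.6 eq. (11.149), (11.151)] -/
theorem dWinf_neg : Eq.dWinf < 0 := by
  rw [Eq.dWinf, externalEnergy_xi]
  have hΛ : Vacuum.wallFactorInf 3 kk 1 < 1 :=
    Vacuum.wallFactorInf_lt_one (by norm_num) (by rw [kk]; norm_num) one_pos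
  have hneg : RwmFRS1.boundaryForm (1 * deriv Eq.xi 1 / Eq.xi 1) (Vacuum.wallFactorInf 3 kk 1) < 0 := by
    rw [boundaryForm_neg_iff]
    linarith [lambdaCrit_bounds.1]
  exact mul_neg_of_neg_of_pos hneg xi_one_sq_pos

/-- **SENTENCE 3 (ideal wall at `b = 21/20·a`): `δW_b > 0`** — `Λ_b ≥ 6.847 > Λ_crit`.
[cite: Freidberg2014, §11.5.6 eq. (11.149), (11.151)] -/
theorem dWb_pos : 0 < Eq.dWb (21 / 20) := by
  rw [Eq.dWb, externalEnergy_xi]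
  have hΛ : (6847 / 1000 : ℝ) ≤ Vacuum.wallFactor 3 kk 1 (21 / 20) := by
    rw [wallFactor_eq, show (1 / 5 : ℝ) * (21 / 20) = 21 / 100 by norm_num]
    exact lambdaWall_21_bounds.1
  have hpos : 0 < RwmFRS1.boundaryForm (1 * deriv Eq.xi 1 / Eq.xi 1) (Vacuum.wallFactor 3 kk 1 (21 / 20)) := by
    rw [boundaryForm_pos_iff]
    linarith [lambdaCrit_bounds.2]
  exact mul_pos hpos xi_one_sq_pos

/-- **Ideal wall at `b = 11/10·a`: `δW_b < 0`** — `Λ_b ≤ 3.576 < Λ_crit` (wall too far). [cite: Freidberg2014, §11.5.6 eq. (11.149)] -/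
theorem dWb_neg : Eq.dWb (11 / 10) < 0 := by
  rw [Eq.dWb, externalEnergy_xi]
  have hΛ : Vacuum.wallFactor 3 kk 1 (11 / 10) ≤ (3576 / 1000 : ℝ) := by
    rw [wallFactor_eq, show (1 / 5 : ℝ) * (11 / 10) = 11 / 50 by norm_num]
    exact lambdaWall_22_le
  have hneg : RwmFRS1.boundaryForm (1 * deriv Eq.xi 1 / Eq.xi 1) (Vacuum.wallFactor 3 kk 1 (11 / 10)) < 0 := by
    rw [boundaryForm_neg_iff]
    linarith [lambdaCrit_bounds.1]
  exact mul_neg_of_neg_of_pos hneg xi_one_sq_pos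

/-- The marginal solution `ξ₁` is admissible. [instance data] -/
theorem xi_admissible : IsAdmissible Eq.xi :=
  ⟨Eq.xi_contDiffOn, 1, ⟨zero_le_one, le_rfl⟩, Eq.xi_ne_zero 1 ⟨one_pos, le_rfl⟩⟩

/-- **NEWCOMB'S EXTERNAL-MODE TEST FOR MODEL M_RWM,eq, MODE `(3,1)`** (lit-4's `newcombExternalModes_iff` instantiated with
the kernel solution `ξ₁`): for every wall factor `Λ`, ALL admissible displacements have positive external energy iff
`δŴ(L, Λ)·ξ₁(1)² > 0`. [cite: Freidberg2014, §11.5.3 eq. (11.118)] -/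
theorem externalModes_iff (Λ : ℝ) :
    (∀ ξ : ℝ → ℝ, IsAdmissible ξ → 0 < Peq.externalEnergy 3 kk 1 Λ ξ) ↔
      0 < RwmFRS1.boundaryForm (1 * deriv Eq.xi 1 / Eq.xi 1) Λ * Eq.xi 1 ^ 2 := by
  obtain ⟨hBθ, hBz, hp, hBθ0⟩ := Eq.profile_regular (51 / 50)
  have hF : ∀ r ∈ Ioc (0 : ℝ) 1, Peq.kDotB 3 kk r ≠ 0 := fun r hr => Eq.kDotB_ne_zero hr.1 (by nlinarith [hr.1, hr.2])
  have hODE : ∀ r ∈ Ioo (0 : ℝ) 1,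
      HasDerivAt (fun s => Peq.newcombF 3 kk s * deriv Eq.xi s) (Peq.newcombG 3 kk r * Eq.xi r) r :=
    fun r hr => Eq.xi_newcomb ⟨hr.1, by linarith [hr.2]⟩
  have h := Profile.newcombExternalModes_iff (P := Peq) (m := 3) (k := kk) one_pos (by norm_num : (1 : ℝ) < 51 / 50)
    (by norm_num) hBθ hBz hp hBθ0 hF Eq.xi_contDiffOn hODE Eq.xi_ne_zero Λ
  rw [Eq.boundaryForm_mul] at h
  constructor
  · intro hall
    exact h.1 fun ξ hξ hne => hall ξ ⟨hξ, hne⟩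
  · intro hpos ξ hξ
    exact h.2 hpos ξ hξ.1 hξ.2

/-- **SENTENCE 2′ (no wall): NOT every admissible displacement has positive no-wall energy** — indeed `ξ₁` itself has
`δW_∞ < 0` (the external `(3,1)` kink side of MODEL M_RWM,eq; never «the device is unstable»).
[cite: Freidberg2014, §11.5.6 eq. (11.151)] -/
theorem noWall_not_stable :
    ¬ (∀ ξ : ℝ → ℝ, IsAdmissible ξ → 0 < Peq.externalEnergy 3 kk 1 (Vacuum.wallFactorInf 3 kk 1) ξ) := by
  intro hall
  have h := hall Eq.xi xi_admissible
  have h2 := dWinf_neg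
  rw [Eq.dWinf] at h2
  linarith

/-- **SENTENCE 3′ (ideal wall at `b = 21/20·a`): EVERY admissible displacement has positive ideal-wall energy** in MODEL
M_RWM, mode `(3,1)` (wall-stabilised side). [cite: Freidberg2014, §11.5.6 eq. (11.151)] -/
theorem idealWall_stable :
    ∀ ξ : ℝ → ℝ, IsAdmissible ξ → 0 < Peq.externalEnergy 3 kk 1 (Vacuum.wallFactor 3 kk 1 (21 / 20)) ξ := by
  have h := Eq.dWb_pos
  rw [Eq.dWb, externalEnergy_xi] at h
  exact (externalModes_iff _).2 h

/-- **THE IDEAL-WALL WINDOW**: for every DECLARED wall radius `a < b ≤ 21/20·a` all admissible displacements have positive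
energy (`Λ_b` is decreasing in `b`, lit-3 `strictAntiOn_wallFactor`). [cite: Freidberg2014, §11.5.6 eq. (11.150)–(11.151)] -/
theorem idealWall_window {b : ℝ} (hb1 : 1 < b) (hb2 : b ≤ 21 / 20) :
    ∀ ξ : ℝ → ℝ, IsAdmissible ξ → 0 < Peq.externalEnergy 3 kk 1 (Vacuum.wallFactor 3 kk 1 b) ξ := by
  have hk : kk ≠ 0 := by rw [kk]; norm_num
  have hmono := Vacuum.strictAntiOn_wallFactor (m := 3) (by norm_num) hk one_pos
  have hΛ : Vacuum.wallFactor 3 kk 1 (21 / 20) ≤ Vacuum.wallFactor 3 kk 1 b := by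
    rcases eq_or_lt_of_le hb2 with h | h
    · rw [h]
    · exact (hmono (show (1 : ℝ) < b from hb1) (show (1 : ℝ) < 21 / 20 by norm_num) h).le
  have h21 := Eq.dWb_pos
  rw [Eq.dWb, externalEnergy_xi] at h21
  refine (externalModes_iff _).2 ?_
  have hx := xi_one_sq_pos
  have hmonoB := (RwmFRS1.boundaryForm_strictMono (1 * deriv Eq.xi 1 / Eq.xi 1)).monotone hΛ
  have : 0 < RwmFRS1.boundaryForm (1 * deriv Eq.xi 1 / Eq.xi 1) (Vacuum.wallFactor 3 kk 1 (21 / 20)) :=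
    pos_of_mul_pos_left h21 hx.le
  exact mul_pos (lt_of_lt_of_le this hmonoB) hx

/-- **Far walls do not stabilise**: for every `b ≥ 11/10·a` the marginal solution `ξ₁` has negative ideal-wall energy
(MODEL M_RWM,eq, mode `(3,1)`). [cite: Freidberg2014, §11.5.6 eq. (11.150)] -/
theorem dWb_neg_far {b : ℝ} (hb : 11 / 10 ≤ b) : Eq.dWb b < 0 := by
  have hk : kk ≠ 0 := by rw [kk]; norm_num
  have hmono := Vacuum.strictAntiOn_wallFactor (m := 3) (by norm_num) hk one_pos
  have hΛ : Vacuum.wallFactor 3 kk 1 b ≤ Vacuum.wallFactor 3 kk 1 (11 / 10) := by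
    rcases eq_or_lt_of_le hb with h | h
    · rw [h]
    · exact (hmono (show (1 : ℝ) < 11 / 10 by norm_num) (show (1 : ℝ) < b by linarith) h).le
  have h11 := Eq.dWb_neg
  rw [Eq.dWb, externalEnergy_xi] at h11 ⊢
  have hx := xi_one_sq_pos
  have hmonoB := (RwmFRS1.boundaryForm_strictMono (1 * deriv Eq.xi 1 / Eq.xi 1)).monotone hΛ
  have : RwmFRS1.boundaryForm (1 * deriv Eq.xi 1 / Eq.xi 1) (Vacuum.wallFactor 3 kk 1 (11 / 10)) < 0 :=
    neg_of_mul_neg_left (by linarith) hx.le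
  exact mul_neg_of_neg_of_pos (lt_of_le_of_lt hmonoB this) hx

/-! ### Sentence 4: the thin-wall resistive wall mode (Freidberg (11.169)) -/

/-- **THE RWM GROWS** in MODEL M_RWM,eq with the thin resistive wall at `b = 21/20·a`: every rate `γ` of the printed
dispersion relation `γτ_w·δW_b = −δW_∞` with `τ_w > 0` is positive. [cite: Freidberg2014, §11.5.6 eq. (11.169)] -/
theorem rwm_grows {γ τw : ℝ} (hτ : 0 < τw) (h : ResistiveWall.IsThinWallRate Eq.dWinf (Eq.dWb (21 / 20)) τw γ) : 0 < γ :=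
  h.growth_pos hτ Eq.dWinf_neg Eq.dWb_pos

/-- **THE CERTIFIED RWM RATE `2.01 < γτ_w < 2.03`** for M_RWM,eq (`b = 21/20·a`; `γτ_w = (Λ_crit − Λ_∞)/(Λ_b − Λ_crit)` with
`Λ_∞ ∈ [0.99666, 0.9967]`, `Λ_b ∈ [6.847, 6.851]`, `Λ_crit ∈ (4.91147, 4.91148)`; VALIDATED float `2.0205`).
[cite: Freidberg2014, §11.5.6 eq. (11.169)] -/
theorem rwm_rate {γ τw : ℝ} (h : ResistiveWall.IsThinWallRate Eq.dWinf (Eq.dWb (21 / 20)) τw γ) :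
    (201 / 100 : ℝ) < γ * τw ∧ γ * τw < (203 / 100 : ℝ) := by
  unfold ResistiveWall.IsThinWallRate at h
  rw [Eq.dWinf, Eq.dWb, externalEnergy_xi, externalEnergy_xi, wallFactorInf_eq, wallFactor_eq,
    show (1 / 5 : ℝ) * (21 / 20) = 21 / 100 by norm_num, RwmFRS1.boundaryForm_eq_sub, RwmFRS1.boundaryForm_eq_sub] at h
  obtain ⟨hc1, hc2⟩ := lambdaCrit_bounds
  obtain ⟨hi1, hi2⟩ := lambdaInf_bounds
  obtain ⟨hb1, hb2⟩ := lambdaWall_21_bounds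
  have hx := xi_one_sq_pos
  set Lc := RwmFRS1.lambdaCrit (1 * deriv Eq.xi 1 / Eq.xi 1) with hLc
  set Li := Vacuum.lambdaInf 3 (1 / 5) with hLi
  set Lb := Vacuum.lambdaWall 3 (1 / 5) (21 / 100) with hLb
  set X := Eq.xi 1 ^ 2 with hX
  -- `γτ_w (Λ_b − Λ_c) = Λ_c − Λ_∞`
  have key : γ * τw * (Lb - Lc) = Lc - Li := by
    have h' : γ * τw * ((Lb - Lc) / 14700 * X) = -((Li - Lc) / 14700 * X) := h
    have hX0 : X ≠ 0 := hx.ne'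
    field_simp at h'
    linarith
  have hd : 0 < Lb - Lc := by linarith
  constructor
  · by_contra hle
    rw [not_lt] at hle
    have : γ * τw * (Lb - Lc) ≤ 201 / 100 * (Lb - Lc) := mul_le_mul_of_nonneg_right hle hd.le
    nlinarith
  · by_contra hle
    rw [not_lt] at hle
    have : 203 / 100 * (Lb - Lc) ≤ γ * τw * (Lb - Lc) := mul_le_mul_of_nonneg_right hle hd.le
    nlinarith

/-! ### The critical wall radius (lit-3 §12, by name) -/

/-- The hypotheses of lit-3's critical-wall theorems for the `(3,1)` marginal solution: `F_a ≠ 0`, `ξ₁(a) ≠ 0`,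
`δW_∞ < 0` (with the mode number as the natural number `3`). [instance data] -/
theorem criticalWall_hyps : Peq.kDotB ((3 : ℕ) : ℝ) kk 1 ≠ 0 ∧ Eq.xi 1 ≠ 0 ∧
    Peq.externalEnergy ((3 : ℕ) : ℝ) kk 1 (Vacuum.wallFactorInf 3 kk 1) Eq.xi < 0 := by
  have h1 : Peq.kDotB 3 kk 1 ≠ 0 := by rw [Eq.edge_values.1]; norm_num
  have h3 := Eq.dWinf_neg
  rw [Eq.dWinf] at h3
  refine ⟨?_, Eq.xi_ne_zero 1 ⟨one_pos, le_rfl⟩, ?_⟩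
  · simpa only [Nat.cast_ofNat] using h1
  · simpa only [Nat.cast_ofNat] using h3

/-- **THE CRITICAL WALL RADIUS EXISTS OUTSIDE THE PLASMA**: `1 < b*` and the ideal-wall energy vanishes there,
`δW_{b*} = 0`. [cite: Freidberg2014, §11.5.6 eqs. (11.149)–(11.151) and Fig. 11.26] -/
theorem criticalWallRadius_spec' : 1 < Peq.criticalWallRadius 3 kk 1 Eq.xi ∧ Eq.dWb (Peq.criticalWallRadius 3 kk 1 Eq.xi) = 0 := by
  obtain ⟨hF, hξ, hinf⟩ := criticalWall_hyps
  have hk : kk ≠ 0 := by rw [kk]; norm_num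
  obtain ⟨h1, -⟩ := Peq.criticalWallRadius_spec (m := 3) (by norm_num) hk one_pos hF hξ hinf
  refine ⟨h1, ?_⟩
  have h0 := (Peq.externalEnergy_wall_eq_zero_iff (m := 3) (by norm_num) hk one_pos hF hξ hinf h1).2 rfl
  rw [Eq.dWb]
  simpa only [Nat.cast_ofNat] using h0

/-- **`δW_b > 0 ⇔ b < b*`** for every wall `b > a = 1`. [cite: Freidberg2014, §11.5.6 eqs. (11.149)–(11.151), p. 491] -/
theorem dWb_pos_iff {b : ℝ} (hb : 1 < b) : 0 < Eq.dWb b ↔ b < Peq.criticalWallRadius 3 kk 1 Eq.xi := by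
  obtain ⟨hF, hξ, hinf⟩ := criticalWall_hyps
  have hk : kk ≠ 0 := by rw [kk]; norm_num
  have h := Peq.externalEnergy_wall_pos_iff (m := 3) (by norm_num) hk one_pos hF hξ hinf hb
  rw [Eq.dWb]
  simpa only [Nat.cast_ofNat] using h

/-- **`δW_b < 0 ⇔ b* < b`** for every wall `b > a = 1`. [cite: Freidberg2014, §11.5.6 eqs. (11.149)–(11.151), p. 491] -/
theorem dWb_neg_iff {b : ℝ} (hb : 1 < b) : Eq.dWb b < 0 ↔ Peq.criticalWallRadius 3 kk 1 Eq.xi < b := by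
  obtain ⟨hF, hξ, hinf⟩ := criticalWall_hyps
  have hk : kk ≠ 0 := by rw [kk]; norm_num
  have h := Peq.externalEnergy_wall_neg_iff (m := 3) (by norm_num) hk one_pos hF hξ hinf hb
  rw [Eq.dWb]
  simpa only [Nat.cast_ofNat] using h

/-- UNIQUENESS: `δW_b = 0 ⇔ b = b*` for every wall `b > a = 1`. [cite: Freidberg2014, §11.5.6 Fig. 11.26] -/
theorem dWb_eq_zero_iff {b : ℝ} (hb : 1 < b) : Eq.dWb b = 0 ↔ b = Peq.criticalWallRadius 3 kk 1 Eq.xi := by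
  obtain ⟨hF, hξ, hinf⟩ := criticalWall_hyps
  have hk : kk ≠ 0 := by rw [kk]; norm_num
  have h := Peq.externalEnergy_wall_eq_zero_iff (m := 3) (by norm_num) hk one_pos hF hξ hinf hb
  rw [Eq.dWb]
  simpa only [Nat.cast_ofNat] using h

/-- **`1.05a < b_crit < 1.10a`**: the critical wall radius of the `(3,1)` mode of MODEL M_RWM,eq lies strictly between the two
DECLARED wall radii (`δW_b(21/20) > 0`, `δW_b(11/10) < 0`; VALIDATED float `1.0709a`). [instance data] -/
theorem criticalWallRadius_bounds : (21 / 20 : ℝ) < Peq.criticalWallRadius 3 kk 1 Eq.xi ∧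
    Peq.criticalWallRadius 3 kk 1 Eq.xi < (11 / 10 : ℝ) :=
  ⟨(dWb_pos_iff (by norm_num)).1 Eq.dWb_pos, (dWb_neg_iff (by norm_num)).1 Eq.dWb_neg⟩

/-- **IDEAL-WALL STABILITY ⇔ WALL INSIDE THE CRITICAL RADIUS**: for every wall `b > a = 1`, ALL admissible
displacements have positive ideal-wall energy in MODEL M_RWM,eq, mode `(3,1)`, iff `b < b*` (lit-4's external-mode test
with the kernel `ξ₁`). [cite: Freidberg2014, §11.5.3 eq. (11.118); §11.5.6 p. 491] -/
theorem idealWall_stable_iff {b : ℝ} (hb : 1 < b) :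
    (∀ ξ : ℝ → ℝ, IsAdmissible ξ → 0 < Peq.externalEnergy 3 kk 1 (Vacuum.wallFactor 3 kk 1 b) ξ) ↔
      b < Peq.criticalWallRadius 3 kk 1 Eq.xi := by
  rw [externalModes_iff, ← externalEnergy_xi, ← dWb_pos_iff hb, Eq.dWb]

/-- **THE RWM GROWS FOR EVERY THIN WALL INSIDE THE CRITICAL RADIUS** (`1 < b < b*`): every `γ` of the printed relation
`γτ_w·δW_b = −δW_∞` with `τ_w > 0` is positive. [cite: Freidberg2014, §11.5.6 eq. (11.169) and p. 492] -/
theorem rwm_grows_of_lt {b γ τw : ℝ} (hb : 1 < b) (hlt : b < Peq.criticalWallRadius 3 kk 1 Eq.xi) (hτ : 0 < τw)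
    (h : ResistiveWall.IsThinWallRate Eq.dWinf (Eq.dWb b) τw γ) : 0 < γ :=
  h.growth_pos hτ Eq.dWinf_neg ((dWb_pos_iff hb).2 hlt)

end Eq

end RwmFRS1

end Summit.Ventures.FusionMHD.Models

end
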